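import Literature.IUT.LogVolume.Corollary22PrimeChoice
import HarnessLib

/-!
# Joshi, *Arithmetic Teichmüller Spaces IV: Proof of the abc-conjecture* (arXiv:2403.10430v2) §5.8,
# «Proof of the Existence Theorem (Theorem 5.7.1)», I: the ARITHMETIC lemmas 5.8.1, 5.8.2, 5.8.7 — TYPED over Joshi's
# running notation `Q = Tate(C_λ) = Σ_v a_v·f_v·log(p_v)`, and DISCHARGED from the tree's [IUTchIV] Prop. 2.1 / Cor. 2.2 files

Object/record file of the abc-iut cell, branch E «type Joshi's construction, test vs S» (rung LADDER-ABC:A2.E; seat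
abc-iut-E-t29, slot T-29; JOSHI-DAG nodes J4:Lem5.8.1, J4:Lem5.8.2, J4:Lem5.8.7; companion `Joshi/ATS4ExistenceLemmasCurves.lean`
holds J4:Lem5.8.8, J4:Lem5.8.9, J4:Lem5.8.11 on the `λ`-line). **No side is taken** on [IUTchIII] Cor. 3.12 / [IUTchIV]
Thm. 1.10, on Joshi's claims (unrefereed arXiv preprint, «Preliminary version for comments») or on Mochizuki's report on
them; typed ≠ proved ≠ endorsed. Locators «p.N l.M» = line M of page file `pNNNN.txt` of the cell's render
`HOME/lit/renders/Joshi-arxiv-2403.10430/` (v2). Nothing of the disputed chain occurs in §5.8: Joshi (p.53 l.23–24) calls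
Thm. 5.7.1 «my formulation of [Mochizuki, 2021d, Corollary 2.2]», and Lemmas 5.8.1/5.8.2/5.8.7 are the CLASSICAL steps
Prop. 2.1 (ii) (Chebyshev/PNT) and (P1)–(P3) of the printed proof of [IUTchIV] Cor. 2.2 (ii), pp. 44–45, which the tree
PROVES (`Literature.IUT.LogVolume.PrimeNumberEstimates`, `…Corollary22PrimeChoice`). So each item is typed AS PRINTED as a
`Prop` carrying Joshi's claim tag and then DISCHARGED by name (E-PLAN R6: «a property that FOLLOWS from the typed signature =
a proved theorem»); no new `Prop` fact, no axiom, no sorry. Object file (E-PLAN R14): imports Literature only.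

CARRIER. Joshi's running notation (p.54 l.9–17) «Q = Tate(C_λ) = Σ_{v∈V_L} a_v·log(v) = Σ_{v∈V_L} a_v·f_v·log(p_v), a_v ∈
ℤ_{≥0}» is bundled as the abstract `TateDatum` (interim carrier; merge-debt: J4:Def5.4.1 `Tate`, J4:Thm5.7.1 = slot T-28
`Joshi/ATS4InitialThetaDataExistence.lean`); its dictionary to the tree is the definitional map `TateDatum.toPrimeChoiceData`
onto `Cor22.PrimeChoiceData` ([IUTchIV] p.44 «h := log(q^∀) = (1/[F:ℚ])·Σ_v h_v·f_v·log(p_v)»: `h_v ↦ a_v`, `h ↦ Q`,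
`[F:ℚ] ↦ [L:ℚ]`, `δ ↦ δ`).

DISCREPANCIES LOCATED (typed side by side, for the faithfulness lane ref-x; located, not adjudicated):
(D1) Lem. 5.8.2 (p.55 l.13) and Thm. 5.7.1 (p.53 l.43) print the factor «log(2·δ·log(Q))», Lem. 5.8.7 (1) (p.56 l.36) and
the proof (5.8.3)/(5.8.4) (p.55 l.29–49) print «log(2·δ·Q)»; [IUTchIV] p.44 has «log(2δ·h)», `h = log(q^∀)` (= Q). The
«log(2·δ·Q)» forms are PROVED (`Lem582`, `Lem587`); the «log(2·δ·log Q)» form `Lem582AsPrinted` is typed only.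
(D2) Lem. 5.8.2 (2) «p | a_v for some v» omits «a_v ≠ 0» («the finite set» A forces it; Lem. 5.8.7 (2) has it; [IUTchIV]
p.44 «divide a nonzero h_v») — typed with `a_v ≠ 0`. (D4) Lem. 5.8.7 assumes only «Q^{1/2} ≥ 5» while its proof via Lem.
5.8.1 needs «Q^{1/2} ≥ ξ_prm» (running hypothesis, p.54 l.27–28) — `Lem587` carries it, `Lem587AsPrinted` is the printed
shape (derived from it under that hypothesis). The printed proof of Lem. 5.8.2 labels (5.8.4), whose summand is
`log(p_v)`, as the estimate of «the second sum Σ_{p|a_v} log(p)» (p.55 l.27–28); the bound that sum needs,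
`Σ_{a_v ≥ Q^{1/2}} log(a_v) ≤ 2δ·Q^{1/2}·log(2δ·Q)`, is [IUTchIV] p.44 = tree `PrimeChoiceData.sum_log_hv_le` (used here).
-/

noncomputable section

open Real Finset
open scoped Chebyshev
open Literature.IUT.LogVolume Literature.IUT.LogVolume.Cor22

namespace Summit.ABC.IUTFork.Joshi.ATS4

/-! ## Lemma 5.8.1 (p.54 l.29–45) — «proved in [Mochizuki, 2010, Lemma 4.1]»; = [IUTchIV] Prop. 2.1 (ii) verbatim -/

/-- **[J-IV] Lemma 5.8.1 (1)** (p.54 l.30–36): «There exists an 5 ≤ ξ_prm ∈ ℝ such that for all Q ≥ ξ_prm one has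
(2/3)·Q ≤ θ(Q) = Σ_{p≤Q} log(p) ≤ (4/3)·Q.» Typed verbatim, `θ` = Mathlib's `Chebyshev.theta`. The sentence is [IUTchIV]
Prop. 2.1 (ii) word for word (tree: `Literature.IUT.LogVolume.IsXiPrm`, `lem581_1_iff`); Joshi cites [GenEll] Lem. 4.1
(constants `1 − ε`, `5/4`; tree `GenEll.lemma41_unconditional`). [claim: Joshi2024ATS4, status: disputed] -/
@[claim "Joshi2024ATS4" "disputed"]
def Lem581_1 : Prop :=
  ∃ ξ_prm : ℝ, 5 ≤ ξ_prm ∧ ∀ Q : ℝ, ξ_prm ≤ Q → 2 / 3 * Q ≤ θ Q ∧ θ Q ≤ 4 / 3 * Q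

/-- Lemma 5.8.1 (1) IS `∃ ξ_prm, IsXiPrm ξ_prm` ([IUTchIV] Prop. 2.1 (ii), tree), by `Iff.rfl`.
[claim: Joshi2024ATS4, status: disputed] -/
theorem lem581_1_iff : Lem581_1 ↔ ∃ ξ_prm : ℝ, IsXiPrm ξ_prm := Iff.rfl

/-- **Lemma 5.8.1 (1) HOLDS** — the tree proves it from the prime number theorem `ϑ(x) ~ x`
(`Literature.IUT.LogVolume.exists_isXiPrm`). DISCHARGED. [claim: Joshi2024ATS4, status: disputed] -/
theorem lem581_1_holds : Lem581_1 := exists_isXiPrm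

/-- **[J-IV] Lemma 5.8.1 (2)** (p.54 l.37–43), for the `ξ_prm` of (1): «If A is a finite set of prime numbers, let
θ_A = Σ_{p∈A} log(p). Then there exists a prime p ∉ A such that p ≤ 2(ξ_prm + θ_A).» `θ_A` is the tree's `thetaSet A`
BY NAME. [claim: Joshi2024ATS4, status: disputed] -/
@[claim "Joshi2024ATS4" "disputed"]
def Lem581_2 (ξ_prm : ℝ) : Prop :=
  ∀ A : Finset ℕ, (∀ p ∈ A, p.Prime) → ∃ p : ℕ, p.Prime ∧ p ∉ A ∧ (p : ℝ) ≤ 2 * (ξ_prm + thetaSet A)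

/-- **Lemma 5.8.1 (2) HOLDS** for every `ξ_prm` as in (1) (tree: `exists_prime_not_mem_le_of_isXiPrm`, whose
«2(θ_A + ξ_prm)» is Joshi's «2(ξ_prm + θ_A)»; that `A` consists of primes is not needed). DISCHARGED.
[claim: Joshi2024ATS4, status: disputed] -/
theorem lem581_2_holds {ξ_prm : ℝ} (hξ : IsXiPrm ξ_prm) : Lem581_2 ξ_prm := by
  intro A _
  obtain ⟨p, hp, hpA, hle⟩ := exists_prime_not_mem_le_of_isXiPrm hξ A
  exact ⟨p, hp, hpA, by rw [add_comm]; exact hle⟩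

/-- **[J-IV] Lemma 5.8.1** (p.54 l.29–43) as ONE statement: there is `ξ_prm ≥ 5` with (1) and, for it, (2).
[claim: Joshi2024ATS4, status: disputed] -/
@[claim "Joshi2024ATS4" "disputed"]
def Lem581 : Prop := ∃ ξ_prm : ℝ, IsXiPrm ξ_prm ∧ Lem581_2 ξ_prm

/-- **Lemma 5.8.1 HOLDS.** DISCHARGED. [claim: Joshi2024ATS4, status: disputed] -/
theorem lem581_holds : Lem581 := by
  obtain ⟨ξ, hξ⟩ := exists_isXiPrm
  exact ⟨ξ, hξ, lem581_2_holds hξ⟩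

/-! ## The running notation of §5.8 (p.54 l.9–17): `Q = Tate(C_λ) = Σ_v a_v·f_v·log(p_v)` -/

/-- **§5.8 running notation** (p.54 l.9–17): «write Q = Tate(C_λ) = Σ_{v∈V_L} a_v·log(v) = Σ_{v∈V_L} a_v·f_v·log(p_v)
with a_v ∈ ℤ_{≥0}» — a finite set `V` of finite places `v` of `L` with `a_v ∈ ℕ` (order of the Tate parameter, Def.
5.4.1 p.51 l.43–52), residue degrees `f_v ≥ 1`, residue characteristics `p_v`; the degree `[L:ℚ] ≥ 1` and Thm. 5.7.1's
`δ` with «[L : ℚ] ≤ δ» (used p.55 l.29, p.56 l.1; `δ = 2^12·3^3·5·d_mod ≥ 2`, p.53 l.35–36). NORMALISATION (PARAPHRASE,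
flagged): p.54 prints `Q = Σ a_v f_v log p_v` without the `1/[M:ℚ]` of Def. 5.4.1 (p.51 l.47–48), while (5.8.5)
(p.56 l.3–7) uses «[L:ℚ]·Q·Q^{−1/2} = Q^{−1/2}·Σ_v a_v·f_v·log(p_v)» with it; typed WITH it (`degL·Q = Σ …`; `degL = 1`
is the p.54 display). Interim carrier (merge-debt: T-28's `Tate`). OUR nearest: `Cor22.PrimeChoiceData`.
[claim: Joshi2024ATS4, status: disputed] -/
structure TateDatum where
  /-- index type of the finite places of `L` -/
  ι : Type
  /-- the finite set `V_L` of places carrying the sum -/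
  V : Finset ι
  /-- `a_v ∈ ℤ_{≥0}` -/
  a : ι → ℕ
  /-- residue degrees `f_v` -/
  f : ι → ℕ
  /-- `f_v ≥ 1` -/
  one_le_f : ∀ v ∈ V, 1 ≤ f v
  /-- residue characteristics `p_v` -/
  p : ι → ℕ
  /-- `p_v` is a prime number -/
  p_prime : ∀ v ∈ V, (p v).Prime
  /-- `[L : ℚ]` -/
  degL : ℕ
  /-- `[L : ℚ] ≥ 1` -/
  one_le_degL : 1 ≤ degL
  /-- Thm. 5.7.1's `δ` -/
  δ : ℝ
  /-- `δ ≥ 2` -/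
  two_le_δ : 2 ≤ δ
  /-- «[L : ℚ] ≤ δ» (p.56 l.1) -/
  degL_le_δ : (degL : ℝ) ≤ δ
  /-- `Q = Tate(C_λ)` -/
  Q : ℝ
  /-- `[L:ℚ]·Q = Σ_{v∈V_L} a_v·f_v·log(p_v)` -/
  Q_def : (degL : ℝ) * Q = ∑ v ∈ V, (a v : ℝ) * (f v : ℝ) * Real.log (p v)

namespace TateDatum

variable (𝔗 : TateDatum)

/-- DICTIONARY MAP (definitional): Joshi's §5.8 datum together with a `ξ_prm` of Lemma 5.8.1 (1) satisfying the running
hypothesis «Q^{1/2} ≥ ξ_prm» (p.54 l.27–28) IS a `Cor22.PrimeChoiceData` ([IUTchIV] p.44: `h_v ↦ a_v`, `h ↦ Q`, `d ↦ [L:ℚ]`).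
[claim: Joshi2024ATS4, status: disputed] -/
def toPrimeChoiceData (ξ : ℝ) (hξ : IsXiPrm ξ) (hξQ : ξ ≤ Real.sqrt 𝔗.Q) : PrimeChoiceData where
  ι := 𝔗.ι
  instDecEq := Classical.decEq _
  V := 𝔗.V
  hv := 𝔗.a
  fv := 𝔗.f
  one_le_fv := 𝔗.one_le_f
  pv := 𝔗.p
  pv_prime := 𝔗.p_prime
  d := 𝔗.degL
  one_le_d := 𝔗.one_le_degL
  δ := 𝔗.δ
  two_le_δ := 𝔗.two_le_δ
  d_le_δ := 𝔗.degL_le_δ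
  h := 𝔗.Q
  h_def := 𝔗.Q_def
  ξ := ξ
  isXiPrm := hξ
  ξ_le_sqrt := hξQ

/-- The places with «a_v ≥ Q^{1/2}» (p.55 l.7, l.38–53). [claim: Joshi2024ATS4, status: disputed] -/
def bigPlaces : Finset 𝔗.ι := 𝔗.V.filter (fun v => Real.sqrt 𝔗.Q ≤ (𝔗.a v : ℝ))

/-- **The set `A` of Lemma 5.8.2** (p.55 l.1–7): «the finite set of primes p such that either (1) p ≤ Q^{1/2}, or
(2) p | a_v for some v ∈ V^non_L [with a_v ≠ 0 — (D2) of the module docstring], or (3) p = p_v for some v ∈ V^non_L for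
which a_v ≥ Q^{1/2}». (For a natural number `p`, `p ≤ Q^{1/2} ↔ p ≤ ⌊Q^{1/2}⌋`.) [claim: Joshi2024ATS4, status: disputed] -/
def lem582Set : Finset ℕ :=
  Nat.primesLE ⌊Real.sqrt 𝔗.Q⌋₊ ∪ (𝔗.V.filter (fun v => 𝔗.a v ≠ 0)).biUnion (fun v => (𝔗.a v).primeFactors) ∪
    𝔗.bigPlaces.image 𝔗.p

/-- **[J-IV] Lemma 5.8.2 AS PRINTED** (p.55 l.8–13): «θ_A = Σ_{p∈A} log(p) ≤ −ξ_prm + 5·δ·Q^{1/2}·log(2·δ·log(Q))» — with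
the inner `log(Q)` as printed ((D1): STRONGER than the form the printed proof derives; typed, NOT proved, no claim made
about its truth). [claim: Joshi2024ATS4, status: disputed] -/
@[claim "Joshi2024ATS4" "disputed"]
def Lem582AsPrinted (ξ_prm : ℝ) : Prop :=
  thetaSet 𝔗.lem582Set ≤ -ξ_prm + 5 * 𝔗.δ * Real.sqrt 𝔗.Q * Real.log (2 * 𝔗.δ * Real.log 𝔗.Q)

/-- **[J-IV] Lemma 5.8.2, OUR READING** (p.55 l.8–13 with the factor «log(2·δ·Q)» of Lem. 5.8.7 (1) p.56 l.36 and of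
(5.8.3)/(5.8.4); = [IUTchIV] Cor. 2.2 (ii) proof p.44 «θ_A ≤ −ξ_prm + 5δ·h^{1/2}·log(2δ·h)»): `θ_A ≤ −ξ_prm +
5·δ·Q^{1/2}·log(2·δ·Q)`. PROVED below under the running hypothesis «Q^{1/2} ≥ ξ_prm» (p.54 l.27–28).
[claim: Joshi2024ATS4, status: disputed] -/
def Lem582 (ξ_prm : ℝ) : Prop :=
  thetaSet 𝔗.lem582Set ≤ -ξ_prm + 5 * 𝔗.δ * Real.sqrt 𝔗.Q * Real.log (2 * 𝔗.δ * 𝔗.Q)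

/-- **Display (5.8.4)** (p.55 l.45–49): «Σ_{a_v ≥ Q^{1/2}} log(p_v) ≤ δ·Q^{1/2}·log(2δ·Q)» (printed as the estimate of
«the second sum Σ_{p|a_v} log(p)», p.55 l.27–28, though its summand is `log(p_v)`; the bound the second sum needs,
`Σ_{a_v ≥ Q^{1/2}} log(a_v) ≤ 2δ·Q^{1/2}·log(2δ·Q)`, is [IUTchIV] p.44 = tree `PrimeChoiceData.sum_log_hv_le`, used in
`lem582_holds`). [claim: Joshi2024ATS4, status: disputed] -/
@[claim "Joshi2024ATS4" "disputed"]
def Ineq584 : Prop :=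
  ∑ v ∈ 𝔗.bigPlaces, Real.log (𝔗.p v : ℝ) ≤ 𝔗.δ * Real.sqrt 𝔗.Q * Real.log (2 * 𝔗.δ * 𝔗.Q)

/-- **Display (5.8.6)** (p.56 l.27–31, end of the chain (5.8.5) p.56 l.1–26): «Σ_{p = p_v, a_v ≥ Q^{1/2}} log(p) ≤
δ·Q^{1/2}» (sum over the SET of primes `{p_v : a_v ≥ Q^{1/2}}`). [claim: Joshi2024ATS4, status: disputed] -/
@[claim "Joshi2024ATS4" "disputed"]
def Ineq586 : Prop := ∑ q ∈ 𝔗.bigPlaces.image 𝔗.p, Real.log (q : ℝ) ≤ 𝔗.δ * Real.sqrt 𝔗.Q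

/-- **The conclusion of Lemma 5.8.7 for a prime `ℓ`** (p.56 l.35–40): «(1) Q^{1/2} ≤ ℓ ≤ 10·δ·Q^{1/2}·log(2·δ·Q);
(2) ℓ ∤ a_v for any a_v ≠ 0 and v ∈ V^non_L; (3) if ℓ = p_v for some v ∈ V^non_L, then a_v < Q^{1/2}» — ONE `ℓ` for the
three sub-items (the `ℓ` of (2), (3) is the `ℓ` of (1)). [claim: Joshi2024ATS4, status: disputed] -/
def Lem587Concl (ℓ : ℕ) : Prop :=
  ℓ.Prime ∧ (Real.sqrt 𝔗.Q ≤ ℓ ∧ (ℓ : ℝ) ≤ 10 * 𝔗.δ * Real.sqrt 𝔗.Q * Real.log (2 * 𝔗.δ * 𝔗.Q)) ∧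
    (∀ v ∈ 𝔗.V, 𝔗.a v ≠ 0 → ¬ ℓ ∣ 𝔗.a v) ∧ (∀ v ∈ 𝔗.V, 𝔗.p v = ℓ → (𝔗.a v : ℝ) < Real.sqrt 𝔗.Q)

/-- **[J-IV] Lemma 5.8.7 AS PRINTED** (p.56 l.33–40): «Assume that Q^{1/2} ≥ 5, the following assertions hold: (1) There
exists a rational prime ℓ satisfying …; (2) …; (3) …». Printed hypothesis only `Q^{1/2} ≥ 5`; the printed proof
(«immediate from Lemma 5.8.2 and Lemma 5.8.1», p.56 l.41–42) applies Lem. 5.8.1 at `Q^{1/2}`, i.e. uses the running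
hypothesis «Q^{1/2} ≥ ξ_prm ≥ 5» (p.54 l.27–28) of `Lem587`; derived from it below (`lem587AsPrinted_of_le_sqrt`).
[claim: Joshi2024ATS4, status: disputed] -/
@[claim "Joshi2024ATS4" "disputed"]
def Lem587AsPrinted : Prop := 5 ≤ Real.sqrt 𝔗.Q → ∃ ℓ : ℕ, 𝔗.Lem587Concl ℓ

/-- **[J-IV] Lemma 5.8.7** «with above notations» (p.56 l.33–40 + p.54 l.27–28 «for any point … not in Exc, one has
Q^{1/2} ≥ ξ_prm ≥ 5»): for `ξ_prm` as in Lem. 5.8.1 (1) with `ξ_prm ≤ Q^{1/2}` there is a prime `ℓ` with (1), (2), (3).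
= [IUTchIV] Cor. 2.2 (ii) proof (P1)–(P3), p.45. [claim: Joshi2024ATS4, status: disputed] -/
def Lem587 (ξ_prm : ℝ) : Prop := IsXiPrm ξ_prm → ξ_prm ≤ Real.sqrt 𝔗.Q → ∃ ℓ : ℕ, 𝔗.Lem587Concl ℓ

/-- **Lemma 5.8.7 HOLDS** (tree: `Cor22.PrimeChoiceData.exists_prime_P1_P2_P3`, [IUTchIV] p.45, through the dictionary
`toPrimeChoiceData`). DISCHARGED. [claim: Joshi2024ATS4, status: disputed] -/
theorem lem587_holds (ξ_prm : ℝ) : 𝔗.Lem587 ξ_prm := by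
  intro hξ hξQ
  obtain ⟨l, hl, h1, h2, h3, h4⟩ := (𝔗.toPrimeChoiceData ξ_prm hξ hξQ).exists_prime_P1_P2_P3
  exact ⟨l, hl, ⟨h1, h2⟩, h3, h4⟩

/-- The running hypothesis implies the printed one: `ξ_prm ≤ Q^{1/2} ⟹ 5 ≤ Q^{1/2}` (p.54 l.28 «Q^{1/2} ≥ ξ_prm ≥ 5»), and
then the printed Lemma 5.8.7 holds. [claim: Joshi2024ATS4, status: disputed] -/
theorem lem587AsPrinted_of_le_sqrt {ξ_prm : ℝ} (hξ : IsXiPrm ξ_prm) (hξQ : ξ_prm ≤ Real.sqrt 𝔗.Q) :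
    5 ≤ Real.sqrt 𝔗.Q ∧ 𝔗.Lem587AsPrinted :=
  ⟨le_trans hξ.1 hξQ, fun _ => 𝔗.lem587_holds ξ_prm hξ hξQ⟩

/-! ### The estimates of the printed proof of Lemma 5.8.2 (p.55 l.14 – p.56 l.32) -/

/-- `Σ_{p ∈ ⋃_{x∈s} t(x)} g(p) ≤ Σ_{x∈s} Σ_{p∈t(x)} g(p)` for `g ≥ 0`. [folklore] -/
private theorem sum_biUnion_le {κ : Type*} (s : Finset κ) (t : κ → Finset ℕ) (g : ℕ → ℝ) (hg : ∀ n, 0 ≤ g n) :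
    ∑ q ∈ s.biUnion t, g q ≤ ∑ x ∈ s, ∑ q ∈ t x, g q := by
  classical
  induction s using Finset.induction_on with
  | empty => simp
  | insert a s ha ih =>
    rw [Finset.biUnion_insert, Finset.sum_insert ha]
    have hu : ∑ q ∈ t a ∪ s.biUnion t, g q ≤ ∑ q ∈ t a, g q + ∑ q ∈ s.biUnion t, g q := by
      rw [← Finset.sum_union_inter]
      have : 0 ≤ ∑ q ∈ t a ∩ s.biUnion t, g q := Finset.sum_nonneg fun q _ => hg q
      linarith
    linarith

/-- `Σ_{A ∪ B} g ≤ Σ_A g + Σ_B g` for `g ≥ 0`. [folklore] -/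
private theorem sum_union_le (A B : Finset ℕ) (g : ℕ → ℝ) (hg : ∀ n, 0 ≤ g n) :
    ∑ q ∈ A ∪ B, g q ≤ ∑ q ∈ A, g q + ∑ q ∈ B, g q := by
  rw [← Finset.sum_union_inter]
  have : 0 ≤ ∑ q ∈ A ∩ B, g q := Finset.sum_nonneg fun q _ => hg q
  linarith

/-- For `n ≥ 1`: `Σ_{p | n} log p ≤ log n` (the radical divides `n`). [folklore] -/
private theorem sum_log_primeFactors_le {n : ℕ} (hn : n ≠ 0) : ∑ q ∈ n.primeFactors, Real.log q ≤ Real.log n := by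
  have hprod : (∏ q ∈ n.primeFactors, (q : ℝ)) = ((∏ q ∈ n.primeFactors, q : ℕ) : ℝ) := by push_cast; rfl
  rw [← Real.log_prod (s := n.primeFactors) (f := fun q : ℕ => (q : ℝ))
    (fun q hq => by exact_mod_cast (Nat.prime_of_mem_primeFactors hq).ne_zero), hprod]
  apply Real.log_le_log
  · exact_mod_cast Finset.prod_pos fun q hq => (Nat.prime_of_mem_primeFactors hq).pos
  · exact_mod_cast Nat.le_of_dvd (Nat.pos_of_ne_zero hn) (Nat.prod_primeFactors_dvd n)

/-- Under the running hypothesis: `Q^{1/2} ≥ 5`, hence `Q ≥ 25` and «log(2δ·Q) ≥ 1». [folklore] -/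
private theorem one_le_log_two_mul {ξ : ℝ} (hξ : IsXiPrm ξ) (hξQ : ξ ≤ Real.sqrt 𝔗.Q) :
    5 ≤ Real.sqrt 𝔗.Q ∧ 25 ≤ 𝔗.Q ∧ 1 ≤ Real.log (2 * 𝔗.δ * 𝔗.Q) := by
  have hs : 5 ≤ Real.sqrt 𝔗.Q := le_trans hξ.1 hξQ
  have hQ0 : 0 < 𝔗.Q := by
    by_contra hle
    rw [not_lt] at hle
    rw [Real.sqrt_eq_zero'.mpr hle] at hs
    linarith
  have hQ : 25 ≤ 𝔗.Q := by nlinarith [Real.sq_sqrt hQ0.le]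
  refine ⟨hs, hQ, ?_⟩
  have h4 : (4 : ℝ) ≤ 2 * 𝔗.δ * 𝔗.Q := by nlinarith [𝔗.two_le_δ]
  have he : Real.exp 1 ≤ 4 := by have := Real.exp_one_lt_d9; linarith
  calc (1 : ℝ) = Real.log (Real.exp 1) := (Real.log_exp 1).symm
    _ ≤ Real.log 4 := Real.log_le_log (Real.exp_pos 1) he
    _ ≤ Real.log (2 * 𝔗.δ * 𝔗.Q) := Real.log_le_log (by norm_num) h4

/-- The (S3)-estimate of [IUTchIV] p.44 in Joshi's notation, sum over `v`: «Σ_{a_v ≥ Q^{1/2}} log(p_v) ≤ δ·Q^{1/2}» (the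
chain (5.8.5), p.56 l.1–21; tree `PrimeChoiceData.sum_log_pv_le`). [claim: Joshi2024ATS4, status: disputed] -/
theorem sum_log_p_bigPlaces_le {ξ : ℝ} (hξ : IsXiPrm ξ) (hξQ : ξ ≤ Real.sqrt 𝔗.Q) :
    ∑ v ∈ 𝔗.bigPlaces, Real.log (𝔗.p v : ℝ) ≤ 𝔗.δ * Real.sqrt 𝔗.Q :=
  (𝔗.toPrimeChoiceData ξ hξ hξQ).sum_log_pv_le

/-- **(5.8.6) HOLDS** (sum over the image `{p_v}` ≤ sum over `v`). DISCHARGED. [claim: Joshi2024ATS4, status: disputed] -/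
theorem ineq586_holds {ξ : ℝ} (hξ : IsXiPrm ξ) (hξQ : ξ ≤ Real.sqrt 𝔗.Q) : 𝔗.Ineq586 :=
  le_trans (Finset.sum_image_le_of_nonneg fun q _ => Real.log_natCast_nonneg q)
    (𝔗.sum_log_p_bigPlaces_le hξ hξQ)

/-- **(5.8.4) HOLDS** (from (5.8.6)'s `v`-sum form and «log(2δ·Q) ≥ 1»). DISCHARGED. [claim: Joshi2024ATS4, status: disputed] -/
theorem ineq584_holds {ξ : ℝ} (hξ : IsXiPrm ξ) (hξQ : ξ ≤ Real.sqrt 𝔗.Q) : 𝔗.Ineq584 := by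
  obtain ⟨hs, _, hlog⟩ := 𝔗.one_le_log_two_mul hξ hξQ
  have h := 𝔗.sum_log_p_bigPlaces_le hξ hξQ
  have hδ := 𝔗.two_le_δ
  have : 𝔗.δ * Real.sqrt 𝔗.Q * 1 ≤ 𝔗.δ * Real.sqrt 𝔗.Q * Real.log (2 * 𝔗.δ * 𝔗.Q) :=
    mul_le_mul_of_nonneg_left hlog (by nlinarith)
  unfold Ineq584
  linarith

/-- **The `θ_A` estimate of the printed proof, repaired as in [IUTchIV] p.44**: `θ_A ≤ 2·Q^{1/2} + δ·Q^{1/2} +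
2δ·Q^{1/2}·log(2δ·Q)` — first sum by Lem. 5.8.1 (1) at `Q^{1/2}` («≤ (4/3)·Q^{1/2}», p.55 l.25–26), second sum through
`Σ_{p | a_v} log p ≤ log(a_v)` and `Σ_{a_v ≥ Q^{1/2}} log(a_v) ≤ 2δ·Q^{1/2}·log(2δ·Q)` (a prime dividing some
`0 < a_v < Q^{1/2}` is `< Q^{1/2}`, i.e. in the first sum), third sum by (5.8.6). [claim: Joshi2024ATS4, status: disputed] -/
theorem thetaSet_lem582Set_le {ξ : ℝ} (hξ : IsXiPrm ξ) (hξQ : ξ ≤ Real.sqrt 𝔗.Q) :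
    thetaSet 𝔗.lem582Set ≤
      2 * Real.sqrt 𝔗.Q + 𝔗.δ * Real.sqrt 𝔗.Q + 2 * 𝔗.δ * Real.sqrt 𝔗.Q * Real.log (2 * 𝔗.δ * 𝔗.Q) := by
  classical
  set A := 𝔗.toPrimeChoiceData ξ hξ hξQ with hA
  have hg : ∀ n : ℕ, 0 ≤ Real.log (n : ℝ) := fun n => Real.log_natCast_nonneg n
  set S1 : Finset ℕ := Nat.primesLE ⌊Real.sqrt 𝔗.Q⌋₊ with hS1
  set S2 : Finset ℕ := (𝔗.V.filter (fun v => 𝔗.a v ≠ 0)).biUnion (fun v => (𝔗.a v).primeFactors) with hS2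
  set S2' : Finset ℕ := 𝔗.bigPlaces.biUnion (fun v => (𝔗.a v).primeFactors) with hS2'
  set S3 : Finset ℕ := 𝔗.bigPlaces.image 𝔗.p with hS3
  -- Joshi's `A ⊆ S1 ∪ S2' ∪ S3`
  have hsub : 𝔗.lem582Set ⊆ S1 ∪ S2' ∪ S3 := by
    intro q hq
    simp only [lem582Set, Finset.mem_union] at hq
    rcases hq with (h1 | h2) | h3
    · exact Finset.mem_union_left _ (Finset.mem_union_left _ h1)
    · rw [Finset.mem_biUnion] at h2
      obtain ⟨v, hv, hqv⟩ := h2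
      rw [Finset.mem_filter] at hv
      rcases le_or_gt (Real.sqrt 𝔗.Q) (𝔗.a v : ℝ) with hge | hlt
      · refine Finset.mem_union_left _ (Finset.mem_union_right _ ?_)
        rw [hS2', Finset.mem_biUnion]
        exact ⟨v, by rw [bigPlaces, Finset.mem_filter]; exact ⟨hv.1, hge⟩, hqv⟩
      · refine Finset.mem_union_left _ (Finset.mem_union_left _ ?_)
        have hqp : q.Prime := Nat.prime_of_mem_primeFactors hqv
        have hqle : (q : ℝ) ≤ 𝔗.a v := by
          exact_mod_cast Nat.le_of_dvd (Nat.pos_of_ne_zero hv.2) (Nat.dvd_of_mem_primeFactors hqv)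
        rw [hS1, Nat.mem_primesLE]
        exact ⟨Nat.le_floor (by linarith), hqp⟩
    · exact Finset.mem_union_right _ h3
  -- the three sums
  have h1 : ∑ q ∈ S1, Real.log (q : ℝ) ≤ 2 * Real.sqrt 𝔗.Q := by
    have hθ1 : θ (Real.sqrt 𝔗.Q) = ∑ q ∈ S1, Real.log (q : ℝ) := by rw [Chebyshev.theta_eq_sum_primesLE]
    have := (hξ.2 (Real.sqrt 𝔗.Q) hξQ).2
    rw [hθ1] at this
    linarith [le_trans hξ.1 hξQ]
  have h2 : ∑ q ∈ S2', Real.log (q : ℝ) ≤ 2 * 𝔗.δ * Real.sqrt 𝔗.Q * Real.log (2 * 𝔗.δ * 𝔗.Q) := by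
    refine le_trans (sum_biUnion_le 𝔗.bigPlaces _ _ hg) (le_trans (Finset.sum_le_sum fun v hv => ?_) A.sum_log_hv_le)
    have hv' : Real.sqrt 𝔗.Q ≤ (𝔗.a v : ℝ) := (Finset.mem_filter.mp hv).2
    exact sum_log_primeFactors_le (by
      intro h0; rw [h0] at hv'; push_cast at hv'; linarith [le_trans hξ.1 hξQ])
  have h3 : ∑ q ∈ S3, Real.log (q : ℝ) ≤ 𝔗.δ * Real.sqrt 𝔗.Q := 𝔗.ineq586_holds hξ hξQ
  have hmono : thetaSet 𝔗.lem582Set ≤ ∑ q ∈ S1 ∪ S2' ∪ S3, Real.log (q : ℝ) :=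
    Finset.sum_le_sum_of_subset_of_nonneg hsub fun q _ _ => hg q
  have hu1 := sum_union_le (S1 ∪ S2') S3 _ hg
  have hu2 := sum_union_le S1 S2' _ hg
  linarith

/-- **Lemma 5.8.2 (OUR READING `Lem582`) HOLDS** under the running hypothesis «Q^{1/2} ≥ ξ_prm»: `2·Q^{1/2} + δ·Q^{1/2} +
2δ·Q^{1/2}·log(2δ·Q) ≤ −ξ_prm + 5δ·Q^{1/2}·log(2δ·Q)` since `ξ_prm ≤ Q^{1/2}`, `δ ≥ 2`, `log(2δ·Q) ≥ 1`. DISCHARGED.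
[claim: Joshi2024ATS4, status: disputed] -/
theorem lem582_holds {ξ_prm : ℝ} (hξ : IsXiPrm ξ_prm) (hξQ : ξ_prm ≤ Real.sqrt 𝔗.Q) : 𝔗.Lem582 ξ_prm := by
  obtain ⟨hs, _, hlog⟩ := 𝔗.one_le_log_two_mul hξ hξQ
  have h := 𝔗.thetaSet_lem582Set_le hξ hξQ
  have hδ := 𝔗.two_le_δ
  have hsl : 0 ≤ Real.sqrt 𝔗.Q * Real.log (2 * 𝔗.δ * 𝔗.Q) := by positivity
  have h1 : 𝔗.δ * Real.sqrt 𝔗.Q * 1 ≤ 𝔗.δ * Real.sqrt 𝔗.Q * Real.log (2 * 𝔗.δ * 𝔗.Q) :=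
    mul_le_mul_of_nonneg_left hlog (by nlinarith)
  unfold Lem582
  nlinarith

end TateDatum

end Summit.ABC.IUTFork.Joshi.ATS4

end
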